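import Summits.NavierStokesRegularity.FluidComputer.LevelReynoldsFloor
import Summits.NavierStokesRegularity.NavierStokesRegularity.Theorems.FluidComputerCascade
import Literature.Analysis.FluidPDE.CriticalSpacesProofs
import HarnessLib

/-!
# Fluid computer — the level-Reynolds floor READ ON THE INTERFACE: every cascade witness obeys the dyadic floor

HONEST FRAMING (cell `pub-fluidc`, verbatim): *low prior, high value-of-information experiment on Tao's
machine paradigm; NOT a claim that NS blows up.* An implication from the cell's (uninhabited, as far as anyone
knows) interface structure `CascadeWitness`; nothing here is evidence of blow-up.

`LevelReynoldsFloor.dyadic_floor` (Cheskidov–Shvydkoy 2010, Lemma 3.2, contrapositive) is a statement about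
maximal smooth solutions. The cell's interface object is `Literature.Analysis.FluidPDE.FluidComputer.CascadeWitness`,
and the summit side already turns a witness into a maximal smooth Leray–Hopf solution with finite lifespan
(`Theorems.FluidComputer.x5a_of_cascadeWitness'`, through the discharged `H¹⁰_df` theory `h10MildTheory_holds`
and `mildMaximalGivesBlowup_holds`). This file composes the two (PLAN.md §3 p2, item L2 "corollary for the
interface"):

* `dyadic_floor_of_cascadeWitness` — with ONE absolute constant `c > 0`: every cascade witness `W` yields a
  viscosity `ν > 0`, a lifespan `T > 0` and a maximal smooth solution `(u, p)` on `ℝ³ × [0, T)`, Leray–Hopf from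
  `u 0`, whose slices HAVE tempered distributions `U t` (they are `L²` fields), and for EVERY such choice of
  distributions `c ν ≤ limsup_{j → ∞} sup_{t ∈ (0,T)} 2^{-j} ‖Δ̇_j U(t)‖_∞`: the blow-up the witness forces is
  organised through dyadic levels whose level Reynolds numbers do not die (SCHEMA.md 9.21(c) `r_floor = 1`).
* `besov_jump_floor_of_cascadeWitness` (appended 2026-08-23) — the same composition with the ABRUPTNESS floor
  `LevelReynoldsFloor.besov_jump_floor` (Cheskidov–Shvydkoy 2010, Thm. 3.1, contrapositive): the forced blow-up has
  left jumps of size `c ν` in `B^{-1}_{∞,∞}`: `c ν ≤ sup_{t ∈ (0,T]} limsup_{t₀ → t⁻} ‖U t − U t₀‖_{B^{-1}_{∞,∞}}`.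

0 sorry; axioms ⊆ {propext, Classical.choice, Quot.sound}; no def, no named fact.

## References

* A. Cheskidov, R. Shvydkoy, Arch. Ration. Mech. Anal. 195 (2010) 159–169 = arXiv:0708.3067, Lemma 3.2.
  [CheskidovShvydkoy2010]
* T. Tao, *Finite time blowup for an averaged three-dimensional Navier–Stokes equation*, J. Amer. Math. Soc. 29
  (2016), §1.3. [Tao2016AveragedNS]
-/

noncomputable section

open MeasureTheory Set Function Filter Topology TemperedDistribution
open scoped ENNReal NNReal SchwartzMap
open Literature.Analysis.FluidPDE Literature.Analysis.FunctionSpaces Literature.Analysis.FluidPDE.FluidComputer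
open Summit.NavierStokesRegularity.NavierStokesRegularity.Theorems.FluidComputer (x5a_of_cascadeWitness')

namespace Summit.NavierStokesRegularity.FluidComputer.CascadeWitnessFloor

/-- **The slices of a Leray–Hopf solution have tempered distributions** (`u t ∈ L²` for `t ∈ [0, T]`, and an
`L²` field is its own distribution, `isDistributionOf_toTemperedDistribution`; BCD §1.2). [folklore] -/
theorem exists_isDistributionOf_of_isLerayHopfOn {ν T : ℝ}
    {u₀ : EuclideanSpace ℝ (Fin 3) → EuclideanSpace ℝ (Fin 3)}
    {u : ℝ → EuclideanSpace ℝ (Fin 3) → EuclideanSpace ℝ (Fin 3)} (hLH : IsLerayHopfOn T ν 0 u₀ u) :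
    ∃ U : ℝ → 𝓢'(EuclideanSpace ℝ (Fin 3), EuclideanSpace ℂ (Fin 3)),
      ∀ t ∈ Icc 0 T, IsDistributionOf (u t) (U t) := by
  classical
  refine ⟨fun t => if ht : t ∈ Icc 0 T then
      Lp.toTemperedDistribution ((memLp_complexify_comp (hLH.memLp t ht)).toLp _) else 0, fun t ht => ?_⟩
  simp only [dif_pos ht]
  exact isDistributionOf_toTemperedDistribution (hLH.memLp t ht)

/-- **L2 on the interface — every cascade witness obeys the dyadic floor** (Cheskidov–Shvydkoy 2010,
Lemma 3.2, contrapositive, composed with the summit-side X5a extraction `x5a_of_cascadeWitness'`). There is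
an absolute `c > 0` such that every `W : CascadeWitness` yields `ν > 0`, `T > 0` and a maximal smooth solution
`(u, p)` of the unforced Navier–Stokes system on `ℝ³ × [0, T)`, Leray–Hopf from `u 0`, whose slices admit
tempered distributions, and for every family `U t` of distributions of the slices (`t ∈ [0, T]`)
`c ν ≤ limsup_{j → ∞} sup_{t ∈ (0,T)} 2^{-j} ‖Δ̇_j U(t)‖_∞` (`lpBlockWeight (-1) ∞`): the level Reynolds numbers
of the forced blow-up do not tend to zero. [cite: CheskidovShvydkoy2010, Lemma 3.2] -/
theorem dyadic_floor_of_cascadeWitness :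
    ∃ c : ℝ, 0 < c ∧ ∀ W : CascadeWitness, ∃ ν : ℝ, 0 < ν ∧ ∃ T : ℝ, 0 < T ∧
      ∃ (u : ℝ → EuclideanSpace ℝ (Fin 3) → EuclideanSpace ℝ (Fin 3))
        (p : ℝ → EuclideanSpace ℝ (Fin 3) → ℝ),
        IsMaximalSmoothSolution ν 0 u p T ∧ IsLerayHopfOn T ν 0 (u 0) u ∧
        (∃ U : ℝ → 𝓢'(EuclideanSpace ℝ (Fin 3), EuclideanSpace ℂ (Fin 3)),
          ∀ t ∈ Icc 0 T, IsDistributionOf (u t) (U t)) ∧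
        ∀ U : ℝ → 𝓢'(EuclideanSpace ℝ (Fin 3), EuclideanSpace ℂ (Fin 3)),
          (∀ t ∈ Icc 0 T, IsDistributionOf (u t) (U t)) →
          ENNReal.ofReal (c * ν) ≤
            limsup (fun j : ℕ => ⨆ t ∈ Ioo 0 T, lpBlockWeight (-1) ∞ (U t) (j : ℤ)) atTop := by
  obtain ⟨c, hc, H⟩ := LevelReynoldsFloor.dyadic_floor
  refine ⟨c, hc, fun W => ?_⟩
  obtain ⟨ν, hν, T, hT, u, p, hmax, hLH, -⟩ := x5a_of_cascadeWitness' W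
  exact ⟨ν, hν, T, hT, u, p, hmax, hLH, exists_isDistributionOf_of_isLerayHopfOn hLH,
    fun U hU => H ν T hν hT u p U hmax hLH hU⟩

/-- **Every cascade witness forces `B^{-1}_{∞,∞}`-jumps of size `c ν`** (the abruptness floor read on the
interface; Cheskidov–Shvydkoy 2010, Thm. 3.1, contrapositive = `LevelReynoldsFloor.besov_jump_floor`, composed
with `x5a_of_cascadeWitness'`). With one absolute `c > 0`: every `W : CascadeWitness` yields `ν > 0`, `T > 0` and
a maximal smooth Leray–Hopf solution `(u, p)` whose slices admit tempered distributions, and for every family `U t`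
of slice distributions `c ν ≤ sup_{t ∈ (0,T]} limsup_{t₀ → t⁻} ‖U t − U t₀‖_{B^{-1}_{∞,∞}}` — the hand-overs of any
realised machine cannot be uniformly small in the largest critical space. [cite: CheskidovShvydkoy2010, Thm. 3.1] -/
theorem besov_jump_floor_of_cascadeWitness :
    ∃ c : ℝ, 0 < c ∧ ∀ W : CascadeWitness, ∃ ν : ℝ, 0 < ν ∧ ∃ T : ℝ, 0 < T ∧
      ∃ (u : ℝ → EuclideanSpace ℝ (Fin 3) → EuclideanSpace ℝ (Fin 3))
        (p : ℝ → EuclideanSpace ℝ (Fin 3) → ℝ),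
        IsMaximalSmoothSolution ν 0 u p T ∧ IsLerayHopfOn T ν 0 (u 0) u ∧
        (∃ U : ℝ → 𝓢'(EuclideanSpace ℝ (Fin 3), EuclideanSpace ℂ (Fin 3)),
          ∀ t ∈ Icc 0 T, IsDistributionOf (u t) (U t)) ∧
        ∀ U : ℝ → 𝓢'(EuclideanSpace ℝ (Fin 3), EuclideanSpace ℂ (Fin 3)),
          (∀ t ∈ Icc 0 T, IsDistributionOf (u t) (U t)) →
          ENNReal.ofReal (c * ν) ≤
            ⨆ t ∈ Ioc 0 T, limsup (fun t₀ => eBesovNorm (-1) ∞ ∞ (U t - U t₀)) (𝓝[<] t) := by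
  obtain ⟨c, hc, H⟩ := LevelReynoldsFloor.besov_jump_floor
  refine ⟨c, hc, fun W => ?_⟩
  obtain ⟨ν, hν, T, hT, u, p, hmax, hLH, -⟩ := x5a_of_cascadeWitness' W
  exact ⟨ν, hν, T, hT, u, p, hmax, hLH, exists_isDistributionOf_of_isLerayHopfOn hLH,
    fun U hU => H ν T hν hT u p U hmax hLH hU⟩

end Summit.NavierStokesRegularity.FluidComputer.CascadeWitnessFloor

end
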